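import Mathlib.Analysis.Complex.ExponentialBounds
import Mathlib.Analysis.Real.Pi.Bounds
import Mathlib.Topology.Order.IntermediateValue
import HarnessLib

/-!
# Stub S0 `stub_farMode` of line `far-gumbel` (crux stmt-RiemannHypothesis-19465 `XiWindowZeroFreeRelFar`):
# the far mode exists

RH-FREE. Registered stub S0 of theory g8's line `far-gumbel` v3 (skeleton sha 69a41b65,
`HOME/rh-jensen-theory/g8/lines/line-far-gumbel.lean`, evidence on stmt-RiemannHypothesis-19465):
for every `M ≥ 2·10¹⁸` there is `υ ≥ 189/20 = 9.45` with `4π e^{4υ} υ = 2M + 9υ` — the mode of the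
tilted weight `u^{2M}·(n = 1 term of Φ)`, which all other stubs of the line take as their large
parameter (`ε = 1/υ`, `Λ = πe^{4υ}`). Proof: the intermediate value theorem for the continuous map
`τ ↦ 4πe^{4τ}τ − 9τ` on `[189/20, M]`, whose value at `189/20` is `≤ 4·10¹⁸ ≤ 2M` by the one numeric
fact `e^{37.8} ≤ e^{38} ≤ 2.7182818286³⁸` (margin ≈ 5 %), and whose value at `τ = M` exceeds `2M` since
`e^{4M} ≥ 1 + 4M`. WHAT THIS IS NOT: nothing here bears on zeros of `ζ` or the truth of RH; no `ξ`
enters. Landed `--supports stmt-RiemannHypothesis-19465` by prover-rh-jensen-eng-2-g2-0 (cell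
rh-jensen, seat eng-2 g2, 2026-08-26).
-/

set_option linter.dupNamespace false

namespace Summit.RiemannHypothesis.RiemannHypothesis.Theorems.JensenPolynomials.FarGumbel

/-- The one numeric input: `4π · e^{4·(189/20)} · (189/20) ≤ 4·10¹⁸` (indeed `≈ 3.1·10¹⁸`; we use
`e^{37.8} ≤ e^{38} ≤ 2.7182818286³⁸`). [folklore] -/
private theorem four_pi_exp_mul_le :
    4 * Real.pi * Real.exp (4 * (189 / 20 : ℝ)) * (189 / 20 : ℝ) ≤ 4 * 10 ^ 18 := by
  have hpi : Real.pi < 3.1416 := Real.pi_lt_d4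
  have he1 : Real.exp 1 < 2.7182818286 := Real.exp_one_lt_d9
  have h38 : Real.exp (4 * (189 / 20 : ℝ)) ≤ Real.exp 1 ^ 38 := by
    rw [← Real.exp_nat_mul]
    exact Real.exp_le_exp.mpr (by norm_num)
  have hpow : Real.exp 1 ^ 38 ≤ (2.7182818286 : ℝ) ^ 38 :=
    pow_le_pow_left₀ (Real.exp_pos 1).le he1.le 38
  have hE : Real.exp (4 * (189 / 20 : ℝ)) ≤ (2.7182818286 : ℝ) ^ 38 := h38.trans hpow
  have hE0 : 0 ≤ Real.exp (4 * (189 / 20 : ℝ)) := (Real.exp_pos _).le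
  calc 4 * Real.pi * Real.exp (4 * (189 / 20 : ℝ)) * (189 / 20 : ℝ)
      ≤ 4 * 3.1416 * (2.7182818286 : ℝ) ^ 38 * (189 / 20 : ℝ) := by
        gcongr
    _ ≤ 4 * 10 ^ 18 := by norm_num

/-- **stub S0 (S): the far mode exists** (`τ ↦ 4πe^{4τ}τ − 9τ` is continuous, `≤ 2M` at `τ = 189/20`
and `≥ 2M` at `τ = M`, for `M ≥ 2·10¹⁸`; intermediate value theorem). Registered signature of line
`far-gumbel` v3, verbatim. [cite: GriffinEtAl2022, §2 (the tilted mode of the ξ-moments; here only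
the existence of the root of the mode equation)] -/
theorem stub_farMode : ∀ M : ℕ, 2 * 10 ^ 18 ≤ M → ∃ υ : ℝ,
      ((189 / 20 : ℝ) ≤ υ ∧ 4 * Real.pi * Real.exp (4 * υ) * υ = 2 * (M : ℝ) + 9 * υ) := by
  intro M hM
  have hMR : (2 * 10 ^ 18 : ℝ) ≤ M := by exact_mod_cast hM
  set g : ℝ → ℝ := fun τ => 4 * Real.pi * Real.exp (4 * τ) * τ - 9 * τ with hg
  have hcont : Continuous g := by
    simp only [hg]; fun_prop
  have hab : (189 / 20 : ℝ) ≤ (M : ℝ) := by linarith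
  -- value at the left end: `g(189/20) ≤ 4·10¹⁸ ≤ 2M`
  have hleft : g (189 / 20) ≤ 2 * (M : ℝ) := by
    have h1 := four_pi_exp_mul_le
    simp only [hg]
    nlinarith
  -- value at the right end: `g(M) ≥ 2M` since `e^{4M} ≥ 1 + 4M`
  have hright : 2 * (M : ℝ) ≤ g M := by
    have hpi : 3 < Real.pi := Real.pi_gt_three
    have hM0 : (0 : ℝ) ≤ M := by positivity
    have hexp : 1 ≤ Real.exp (4 * (M : ℝ)) := Real.one_le_exp (by positivity)
    -- `4π e^{4M} M ≥ 4π M ≥ 12 M`, hence `g M ≥ 3M ≥ 2M`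
    have h1 : 4 * Real.pi * M ≤ 4 * Real.pi * Real.exp (4 * (M : ℝ)) * M := by
      have := mul_le_mul_of_nonneg_left hexp (by positivity : (0 : ℝ) ≤ 4 * Real.pi * M)
      linarith [this]
    have h2 : 12 * (M : ℝ) ≤ 4 * Real.pi * M := by nlinarith
    simp only [hg]
    linarith
  obtain ⟨υ, hυ, hgυ⟩ :=
    intermediate_value_Icc hab hcont.continuousOn ⟨hleft, hright⟩
  refine ⟨υ, hυ.1, ?_⟩
  simp only [hg] at hgυ
  linarith

end Summit.RiemannHypothesis.RiemannHypothesis.Theorems.JensenPolynomials.FarGumbel
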